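import Summits.QuantumFields.BalabanUV.Beta.GAN24.AveragedPropagatorDefectDecay
import Summits.QuantumFields.BalabanUV.Beta.GAN24.MinimiserOneStepDecay

/-!
# G-an2-4 ∕ (CONV-C), road P2, route R2-S1, VECTOR LAYER, PART 9 — THE ONE-STEP LAW OF `c_n = Q_n𝒢_nQ_n*` IN THE ROW's KERNEL CURRENCY,
# MODULO THE VECTOR `RowDecay` LETTERS: a unit-lattice source decaying from `y′` is mapped by `c_{RN} − c_N` to a field decaying from `y′` at a
# quarter of the rate, with the rate factor `(R−1)∕(RN)` in front — every `d`, every torus (dimension `d+1`), every `a > 0`, `N, R ≥ 1`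

Unit `b2b-balaban-gan24-p2` (gen 30), BINDER row G-an2-4 ∕ (CONV-C), road P2; crux team (2).  Part 5 proved the SUP law; (CONV-C)'s currency is a
KERNEL bound `|𝒦^{(k+1)} − 𝒦^{(k)}|(y,y′) ≤ C₄θ^k e^{−δ₄|y−y′|}`.  With `BlockFieldDecay`'s calculus (gen 29: `RowDecay`, `FieldDecay`, `fieldDecay_mulVec` —
rate halves per resummation), Parts 8∕8b's transports and Part 3's identity, THIS FILE proves:
 * §1 term lemmas for a fine operator `G′` carrying `RowDecay` letters at rate `δ₁`: `fieldDecay_G_Lap_defect`, `fieldDecay_G_gradDiv_defect`,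
   `fieldDecay_G_Pi_defect` (outputs at rate `δ₁∕2`);
 * §2 **`fieldDecay_covOp_succ_sub`** — given the six vector letters in `RowDecay` form (`𝒢_N`, `∇_ν𝒢_N`, `∇_μ∇_ν𝒢_N` at rate `δ`; `𝒢_{RN}`,
   `𝒢_{RN}∇ᴴ_ν`, `𝒢_{RN}∇ᴴ_μ∇ᴴ_ν` at rate `δ∕2`) and a unit bond field `g` with `|g(z)| ≤ V·e^{−δ|z₁ − y′|}`:
   `FieldDecay T Prod.fst ((c_{RN} − c_N)g) (((R−1)∕(RN))·epsVec·V) (δ∕4) y′` with **`epsVec d a C₀ C₀′ C₁′ C₂ C₃′ C₄ δ`** an explicit polynomial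
   (affine in each of `C₀′`, `C₃′C₂`, `C₁′C₄`, `C₀′C₀`, `C₀`; coefficients in `e^{δ}`, `latticeConst(d+1, δ∕2)`, `latticeConst(d+1, δ∕4)`, `d`, `a`);
 * §3 **`norm_covOp_succ_sub_apply_le`** — its kernel reading at `g = δ_{i′}`: `‖(c_{RN} − c_N)(i, i′)‖ ≤ ((R−1)∕(RN))·epsVec·e^{−(δ∕4)|i₁ − i′₁|_{T,∞}}`.
The letters are theorems of the tree at `a = 1` (`VectorRowDecayLetters`, leaf-06 gen 36: every torus for the first-order ones, cubic for the
second-order ones with `C(1 + log n)`); the UNCONDITIONAL cubic corollary with both (CONV-C) clauses is Part 10.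
HONEST SCOPE.  Bookkeeping (`fieldDecay_mulVec` + Parts 3∕4∕8∕8b); `U = 1`; the unit-lattice-read vector constituent only; letters DISPLAYED (no
`def … : Prop`, no named fact); [folklore]; kernel-checked, no `sorry`.  NOT (CONV-C) as typed, NEVER «G-an2-4 closed», NOT NE2, NOT D1, NOT BetaPertH,
NOT continuum, NOT Clay; not in print — our proof.  HONEST DEPENDENCY: continuum YM on T⁴ ⇐ BetaPertH ∧ nine spine estimates (0/9 proved); BetaPertH ⇐
(D1) ∧ (D4) ∧ CAP+tail; G-an2-4 gates asym, D1 and NE2/3/4.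
-/

noncomputable section

open scoped BigOperators ComplexConjugate Matrix

namespace Summit.QuantumFields.BalabanUV.Beta.GAN24.AveragedPropagatorOneStepDecay

open Literature.MathematicalPhysics.QuantumFieldTheory.Balaban1983to89
open B5Prop11Plancherel (Tor fine fdiff shiftM)
open B5Prop11Lower (Lap)
open B5Action121 (GradOp)
open B5Block118 (QvOp)
open B5Blocks16 (blockOf)
open B5DeltaA169 (DeltaA QvAdj)
open B6LowerBound2153Torus (rep)
open B4TorusKernel.MultiPeriod (torusSupNorm)
open B4Sect5Proof (latticeConst latticeConst_nonneg)
open B5G183FreeRowSum (shiftM_mulVec)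
open Summit.QuantumFields.BalabanUV.Beta.GAN24.StaircaseAveragingDefect (stairV fwdDefect adjDefect ratio_nonneg)
open Summit.QuantumFields.BalabanUV.Beta.GAN24.AveragedPropagatorTwoLevel (covOp locOp covOp_succ_sub locOp_stairV_defect)
open Summit.QuantumFields.BalabanUV.Beta.GAN24.AveragedPropagatorDefectFields
open Summit.QuantumFields.BalabanUV.Beta.GAN24.BlockFieldDecay (RowDecay FieldDecay fieldDecay_mulVec)
open Summit.QuantumFields.BalabanUV.Beta.GAN24.MinimiserOneStepDecay (fieldDecay_single)
open Summit.QuantumFields.BalabanUV.Beta.GAN24.AveragedPropagatorLocality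
open Summit.QuantumFields.BalabanUV.Beta.GAN24.AveragedPropagatorDefectDecay

variable {d : ℕ} (N R : ℕ) [NeZero N] [NeZero R] (M : Fin (d + 1) → ℕ) [hM : ∀ μ, NeZero (M μ)]

/-! ## §1 Term lemmas in the kernel currency -/

section Terms

variable (G' : Matrix (Tor (fine (R * N) M) × Fin (d + 1)) (Tor (fine (R * N) M) × Fin (d + 1)) ℂ) {C₁' C₃' : ℝ}

/-- **THE LAPLACIAN-DEFECT TERM WITH DECAY**: from `RowDecay` letters `G′∇′ᴴ_ν` (`C₁′`), `G′∇′ᴴ_μ∇′ᴴ_ν` (`C₃′`) at rate `δ₁ > 0` and decaying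
derivative fields `|∇_νu| ⪯ B₂`, `|∇_ν∇_νu| ⪯ B₄` at rate `δ₁`: `G′((Lap′J − JLap)u)` decays at rate `δ₁∕2` with constant
`(d+1)·ρ·(C₃′B₂ + C₁′e^{δ₁}B₄)·K(δ₁∕2)`. [folklore] -/
theorem fieldDecay_G_Lap_defect {δ₁ : ℝ} (hδ₁ : 0 < δ₁)
    (hG1' : ∀ ν, RowDecay M (fun i : Tor (fine (R * N) M) × Fin (d + 1) => blockOf (R * N) M i.1)
      (fun i : Tor (fine (R * N) M) × Fin (d + 1) => blockOf (R * N) M i.1) (G' * (fdiff (fine (R * N) M) ((R * N : ℕ) : ℂ) ν)ᴴ) C₁' δ₁)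
    (hG3' : ∀ μ ν, RowDecay M (fun i : Tor (fine (R * N) M) × Fin (d + 1) => blockOf (R * N) M i.1)
      (fun i : Tor (fine (R * N) M) × Fin (d + 1) => blockOf (R * N) M i.1)
      (G' * (fdiff (fine (R * N) M) ((R * N : ℕ) : ℂ) μ)ᴴ * (fdiff (fine (R * N) M) ((R * N : ℕ) : ℂ) ν)ᴴ) C₃' δ₁)
    (u : Tor (fine N M) × Fin (d + 1) → ℂ) {B₂ B₄ : ℝ} (hB₂ : 0 ≤ B₂) (hB₄ : 0 ≤ B₄) {y' : Tor M}
    (h2 : ∀ ν, FieldDecay M (fun i : Tor (fine N M) × Fin (d + 1) => blockOf N M i.1) (fdiff (fine N M) (N : ℂ) ν *ᵥ u) B₂ δ₁ y')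
    (h4 : ∀ ν, FieldDecay M (fun i : Tor (fine N M) × Fin (d + 1) => blockOf N M i.1)
      (fdiff (fine N M) (N : ℂ) ν *ᵥ (fdiff (fine N M) (N : ℂ) ν *ᵥ u)) B₄ δ₁ y') :
    FieldDecay M (fun i : Tor (fine (R * N) M) × Fin (d + 1) => blockOf (R * N) M i.1)
      (G' *ᵥ ((Lap (R * N) M * stairV N R M - stairV N R M * Lap N M) *ᵥ u))
      ((d + 1) * ((((R : ℝ) - 1) / ((R : ℝ) * N)) * (C₃' * B₂ + C₁' * (Real.exp δ₁ * B₄)) * latticeConst (d + 1) (δ₁ / 2)))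
      (δ₁ / 2) y' := by
  have hρ := ratio_nonneg N R
  have e : G' *ᵥ ((Lap (R * N) M * stairV N R M - stairV N R M * Lap N M) *ᵥ u)
      = ∑ ν, ((G' * (fdiff (fine (R * N) M) ((R * N : ℕ) : ℂ) ν)ᴴ * (fdiff (fine (R * N) M) ((R * N : ℕ) : ℂ) ν)ᴴ) *ᵥ PhiL N R M ν u
          + (G' * (fdiff (fine (R * N) M) ((R * N : ℕ) : ℂ) ν)ᴴ) *ᵥ PsiF N R M ν u) := by
    rw [Lap_defect_mulVec, Matrix.mulVec_sum]
    refine Finset.sum_congr rfl fun ν _ => ?_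
    rw [Matrix.mulVec_add, Matrix.mulVec_add, ← Matrix.mulVec_mulVec, ← Matrix.mulVec_mulVec, ← Matrix.mulVec_mulVec]
  rw [e]
  have hcard : (Fintype.card (Fin (d + 1)) : ℝ) = d + 1 := by rw [Fintype.card_fin]; push_cast; ring
  rw [← hcard]
  refine FieldDecay.sum_univ fun ν => ?_
  have hA := fieldDecay_mulVec (hG3' ν ν) hδ₁ (fieldDecay_PhiL N R M ν (h2 ν)) (mul_nonneg hρ hB₂)
  have hB := fieldDecay_mulVec (hG1' ν) hδ₁ (fieldDecay_PsiF N R M ν hB₄ hδ₁.le (h4 ν)) (mul_nonneg hρ (by positivity))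
  refine (hA.add hB).mono (le_of_eq (by ring)) ?_ le_rfl
  have := latticeConst_nonneg (d + 1) (half_pos hδ₁).le
  have hC₃ : 0 ≤ C₃' := by
    have := (hG3' ν ν).nonneg
    exact this
  have hC₁ : 0 ≤ C₁' := (hG1' ν).nonneg
  positivity

/-- a negated forward-shifted field decays with constant `e^{δ}`. [folklore] -/
theorem fieldDecay_neg_shiftM {E : Tor (fine (R * N) M) × Fin (d + 1) → ℂ} {b δ₁ : ℝ} {y' : Tor M} (hb : 0 ≤ b) (hδ₁ : 0 ≤ δ₁)
    (h : FieldDecay M (fun i : Tor (fine (R * N) M) × Fin (d + 1) => blockOf (R * N) M i.1) E b δ₁ y') (μ : Fin (d + 1)) :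
    FieldDecay M (fun i : Tor (fine (R * N) M) × Fin (d + 1) => blockOf (R * N) M i.1)
      (-(shiftM (fine (R * N) M) μ *ᵥ E)) (Real.exp δ₁ * b) δ₁ y' := by
  intro i
  rw [Pi.neg_apply, norm_neg, shiftM_mulVec]
  exact fieldDecay_shift_add (R * N) M hb hδ₁ h μ i

/-- **THE GRAD-DIV-DEFECT TERM WITH DECAY**: `G′((∂′∂′ᴴJ − J∂∂ᴴ)u)` decays at rate `δ₁∕2` with constant
`(d+1)²·C₃′e^{2δ₁}ρB₂K + (d+1)²·C₁′e^{δ₁}ρB₄K` (the mixed `∇′∇′ᴴ` moved onto the `∇′ᴴ∇′ᴴ` letter by a shift). [folklore] -/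
theorem fieldDecay_G_gradDiv_defect {δ₁ : ℝ} (hδ₁ : 0 < δ₁)
    (hG1' : ∀ ν, RowDecay M (fun i : Tor (fine (R * N) M) × Fin (d + 1) => blockOf (R * N) M i.1)
      (fun i : Tor (fine (R * N) M) × Fin (d + 1) => blockOf (R * N) M i.1) (G' * (fdiff (fine (R * N) M) ((R * N : ℕ) : ℂ) ν)ᴴ) C₁' δ₁)
    (hG3' : ∀ μ ν, RowDecay M (fun i : Tor (fine (R * N) M) × Fin (d + 1) => blockOf (R * N) M i.1)
      (fun i : Tor (fine (R * N) M) × Fin (d + 1) => blockOf (R * N) M i.1)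
      (G' * (fdiff (fine (R * N) M) ((R * N : ℕ) : ℂ) μ)ᴴ * (fdiff (fine (R * N) M) ((R * N : ℕ) : ℂ) ν)ᴴ) C₃' δ₁)
    (u : Tor (fine N M) × Fin (d + 1) → ℂ) {B₂ B₄ : ℝ} (hB₂ : 0 ≤ B₂) (hB₄ : 0 ≤ B₄) {y' : Tor M}
    (h2 : ∀ ν, FieldDecay M (fun i : Tor (fine N M) × Fin (d + 1) => blockOf N M i.1) (fdiff (fine N M) (N : ℂ) ν *ᵥ u) B₂ δ₁ y')
    (h4 : ∀ μ ν, FieldDecay M (fun i : Tor (fine N M) × Fin (d + 1) => blockOf N M i.1)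
      (fdiff (fine N M) (N : ℂ) ν *ᵥ (fdiff (fine N M) (N : ℂ) μ *ᵥ u)) B₄ δ₁ y') :
    FieldDecay M (fun i : Tor (fine (R * N) M) × Fin (d + 1) => blockOf (R * N) M i.1)
      (G' *ᵥ ((GradOp (fine (R * N) M) ((R * N : ℕ) : ℂ) * (GradOp (fine (R * N) M) ((R * N : ℕ) : ℂ))ᴴ * stairV N R M
        - stairV N R M * (GradOp (fine N M) ((N : ℕ) : ℂ) * (GradOp (fine N M) ((N : ℕ) : ℂ))ᴴ)) *ᵥ u))
      ((d + 1) * ((d + 1) * (C₃' * (Real.exp δ₁ * ((((R : ℝ) - 1) / ((R : ℝ) * N)) * (Real.exp δ₁ * B₂))) * latticeConst (d + 1) (δ₁ / 2)))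
        + (d + 1) * (C₁' * ((((R : ℝ) - 1) / ((R : ℝ) * N)) * ((d + 1) * (Real.exp δ₁ * B₄))) * latticeConst (d + 1) (δ₁ / 2)))
      (δ₁ / 2) y' := by
  have hρ := ratio_nonneg N R
  have e : G' *ᵥ ((GradOp (fine (R * N) M) ((R * N : ℕ) : ℂ) * (GradOp (fine (R * N) M) ((R * N : ℕ) : ℂ))ᴴ * stairV N R M
        - stairV N R M * (GradOp (fine N M) ((N : ℕ) : ℂ) * (GradOp (fine N M) ((N : ℕ) : ℂ))ᴴ)) *ᵥ u)
      = (∑ ν, ∑ μ, (G' * (fdiff (fine (R * N) M) ((R * N : ℕ) : ℂ) μ)ᴴ * (fdiff (fine (R * N) M) ((R * N : ℕ) : ℂ) ν)ᴴ) *ᵥ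
            (-(shiftM (fine (R * N) M) μ *ᵥ AveragedPropagatorDefectFields.emb μ (phiF N R M ν u))))
        + ∑ μ, (G' * (fdiff (fine (R * N) M) ((R * N : ℕ) : ℂ) μ)ᴴ) *ᵥ AveragedPropagatorDefectFields.emb μ (phiLdiv N R M μ u) := by
    rw [gradDiv_defect_mulVec, Matrix.mulVec_add, Matrix.mulVec_sum, Matrix.mulVec_sum]
    congr 1
    · refine Finset.sum_congr rfl fun ν _ => ?_
      rw [Matrix.mulVec_sum]
      refine Finset.sum_congr rfl fun μ _ => ?_
      rw [fdiff_fdiffH_eq_shift, ← Matrix.mulVec_mulVec, ← Matrix.mulVec_mulVec]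
    · refine Finset.sum_congr rfl fun μ _ => ?_
      rw [← Matrix.mulVec_mulVec]
  rw [e]
  have hcard : (Fintype.card (Fin (d + 1)) : ℝ) = d + 1 := by rw [Fintype.card_fin]; push_cast; ring
  have hK := latticeConst_nonneg (d + 1) (half_pos hδ₁).le
  refine FieldDecay.add ?_ ?_
  · rw [← hcard]
    refine FieldDecay.sum_univ fun ν => FieldDecay.sum_univ fun μ => ?_
    have hφ : FieldDecay M (fun i : Tor (fine (R * N) M) × Fin (d + 1) => blockOf (R * N) M i.1)
        (AveragedPropagatorDefectFields.emb μ (phiF N R M ν u)) ((((R : ℝ) - 1) / ((R : ℝ) * N)) * (Real.exp δ₁ * B₂)) δ₁ y' :=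
      fieldDecay_emb (R * N) M (by positivity) (fieldDecay_phiF N R M ν hB₂ hδ₁.le (h2 ν)) μ
    exact fieldDecay_mulVec (hG3' μ ν) hδ₁ (fieldDecay_neg_shiftM N R M (by positivity) hδ₁.le hφ μ) (by positivity)
  · rw [← hcard]
    refine FieldDecay.sum_univ fun μ => ?_
    have hφ : FieldDecay M (fun i : Tor (fine (R * N) M) × Fin (d + 1) => blockOf (R * N) M i.1)
        (AveragedPropagatorDefectFields.emb μ (phiLdiv N R M μ u))
        ((((R : ℝ) - 1) / ((R : ℝ) * N)) * ((Fintype.card (Fin (d + 1)) : ℝ) * (Real.exp δ₁ * B₄))) δ₁ y' := by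
      rw [hcard]
      exact fieldDecay_emb (R * N) M (by positivity) (fieldDecay_phiLdiv N R M μ hB₄ hδ₁.le h4) μ
    exact fieldDecay_mulVec (hG1' μ) hδ₁ hφ (by positivity)

/-- **THE MASS-TERM DEFECT WITH DECAY**: `G′((E₂Q + Q′*E₁)u)` decays at rate `δ₁∕2` with constant
`C₀′ρ(1+e^{δ₁})²B₀K + C₀′e^{δ₁}ρ(1+e^{δ₁})B₀K∕2`. [folklore] -/
theorem fieldDecay_G_Pi_defect {δ₁ C₀' : ℝ} (hδ₁ : 0 < δ₁)
    (hG0' : RowDecay M (fun i : Tor (fine (R * N) M) × Fin (d + 1) => blockOf (R * N) M i.1)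
      (fun i : Tor (fine (R * N) M) × Fin (d + 1) => blockOf (R * N) M i.1) G' C₀' δ₁)
    (u : Tor (fine N M) × Fin (d + 1) → ℂ) {B₀ : ℝ} (hB₀ : 0 ≤ B₀) {y' : Tor M}
    (h0 : FieldDecay M (fun i : Tor (fine N M) × Fin (d + 1) => blockOf N M i.1) u B₀ δ₁ y') :
    FieldDecay M (fun i : Tor (fine (R * N) M) × Fin (d + 1) => blockOf (R * N) M i.1)
      (G' *ᵥ ((adjDefect N R M * QvOp N M + QvAdj (R * N) M * fwdDefect N R M) *ᵥ u))
      (C₀' * ((((R : ℝ) - 1) / ((R : ℝ) * N)) * ((1 + Real.exp δ₁) * ((1 + Real.exp δ₁) * B₀))) * latticeConst (d + 1) (δ₁ / 2)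
        + C₀' * (Real.exp δ₁ * ((((R : ℝ) - 1) / ((R : ℝ) * N)) * ((1 + Real.exp δ₁) / 2 * B₀))) * latticeConst (d + 1) (δ₁ / 2))
      (δ₁ / 2) y' := by
  have hρ := ratio_nonneg N R
  rw [Matrix.add_mulVec, ← Matrix.mulVec_mulVec, ← Matrix.mulVec_mulVec, Matrix.mulVec_add]
  refine FieldDecay.add ?_ ?_
  · have hQ := fieldDecay_QvOp N M hB₀ hδ₁.le h0
    have hE := fieldDecay_adjDefect N R M (by positivity) hδ₁.le hQ
    exact fieldDecay_mulVec hG0' hδ₁ hE (by positivity)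
  · have hE := fieldDecay_fwdDefect N R M hB₀ hδ₁.le h0
    have hQ := fieldDecay_QvAdj (R * N) M (by positivity) hδ₁.le hE
    exact fieldDecay_mulVec hG0' hδ₁ hQ (by positivity)

end Terms

/-! ## §2 The END in the kernel currency, modulo the `RowDecay` letters -/

/-- **the decay-law constant** (per unit of `ρ = (R−1)∕(RN)` and of the source constant `V`): an explicit polynomial in the letters, `e^{δ}`,
`K₂ = latticeConst(d+1, δ∕2)`, `K₄ = latticeConst(d+1, δ∕4)`, `d`, `a` — affine in each of `C₀′`, `C₀`, `C₃′C₂`, `C₁′C₄`, `C₀′C₀`. [folklore] -/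
def epsVec (d : ℕ) (a C₀ C₀' C₁' C₂ C₃' C₄ δ : ℝ) : ℝ :=
  (1 + Real.exp (δ / 2 / 2)) * C₀' * (1 + Real.exp δ) * latticeConst (d + 1) (δ / 2 / 2)
  + (1 + Real.exp (δ / 2)) / 2 * C₀ * Real.exp δ * latticeConst (d + 1) (δ / 2)
  + (1 + Real.exp (δ / 2 / 2)) *
    ( ((d : ℝ) + 1) * (C₃' * C₂ * Real.exp δ * latticeConst (d + 1) (δ / 2)
        + C₁' * Real.exp (δ / 2) * C₄ * Real.exp δ * latticeConst (d + 1) (δ / 2)) * latticeConst (d + 1) (δ / 2 / 2)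
      + (((d : ℝ) + 1) * ((d : ℝ) + 1) * C₃' * Real.exp (δ / 2) * Real.exp (δ / 2) * C₂ * Real.exp δ * latticeConst (d + 1) (δ / 2)
            * latticeConst (d + 1) (δ / 2 / 2)
          + ((d : ℝ) + 1) * C₁' * ((d : ℝ) + 1) * Real.exp (δ / 2) * C₄ * Real.exp δ * latticeConst (d + 1) (δ / 2)
            * latticeConst (d + 1) (δ / 2 / 2))
      + a * (C₀' * (1 + Real.exp (δ / 2)) ^ 2 * C₀ * Real.exp δ * latticeConst (d + 1) (δ / 2) * latticeConst (d + 1) (δ / 2 / 2)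
            + C₀' * Real.exp (δ / 2) * (1 + Real.exp (δ / 2)) / 2 * C₀ * Real.exp δ * latticeConst (d + 1) (δ / 2)
              * latticeConst (d + 1) (δ / 2 / 2)) )

/-- **THE ONE-STEP LAW OF THE AVERAGED PROPAGATOR IN THE KERNEL CURRENCY, MODULO THE VECTOR `RowDecay` LETTERS** (every `d`, every torus of
dimension `d+1`, every `a > 0`, `N, R ≥ 1`): given the letters `𝒢_N` (`C₀`), `∇_ν𝒢_N` (`C₂`), `∇_μ∇_ν𝒢_N` (`C₄`) at rate `δ` and `𝒢_{RN}` (`C₀′`),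
`𝒢_{RN}∇ᴴ_ν` (`C₁′`), `𝒢_{RN}∇ᴴ_μ∇ᴴ_ν` (`C₃′`) at rate `δ∕2` (lower a common rate by `RowDecay.mono`), and a unit bond field `g` with
`|g(z)| ≤ V·e^{−δ|z₁ − y′|_{T,∞}}`: the field `(c_{RN} − c_N)g` satisfies
`|((c_{RN} − c_N)g)(z)| ≤ ((R−1)∕(RN))·epsVec·V·e^{−(δ∕4)|z₁ − y′|_{T,∞}}`. [folklore] -/
theorem fieldDecay_covOp_succ_sub {a : ℝ} (ha : 0 < a) {C₀ C₀' C₁' C₂ C₃' C₄ δ V : ℝ} (hδ : 0 < δ) (hV : 0 ≤ V)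
    (hG0 : RowDecay M (fun i : Tor (fine N M) × Fin (d + 1) => blockOf N M i.1) (fun i : Tor (fine N M) × Fin (d + 1) => blockOf N M i.1)
      (DeltaA N M a)⁻¹ C₀ δ)
    (hG2 : ∀ ν, RowDecay M (fun i : Tor (fine N M) × Fin (d + 1) => blockOf N M i.1) (fun i : Tor (fine N M) × Fin (d + 1) => blockOf N M i.1)
      (fdiff (fine N M) (N : ℂ) ν * (DeltaA N M a)⁻¹) C₂ δ)
    (hG4 : ∀ μ ν, RowDecay M (fun i : Tor (fine N M) × Fin (d + 1) => blockOf N M i.1) (fun i : Tor (fine N M) × Fin (d + 1) => blockOf N M i.1)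
      (fdiff (fine N M) (N : ℂ) μ * fdiff (fine N M) (N : ℂ) ν * (DeltaA N M a)⁻¹) C₄ δ)
    (hG0' : RowDecay M (fun i : Tor (fine (R * N) M) × Fin (d + 1) => blockOf (R * N) M i.1)
      (fun i : Tor (fine (R * N) M) × Fin (d + 1) => blockOf (R * N) M i.1) (DeltaA (R * N) M a)⁻¹ C₀' (δ / 2))
    (hG1' : ∀ ν, RowDecay M (fun i : Tor (fine (R * N) M) × Fin (d + 1) => blockOf (R * N) M i.1)
      (fun i : Tor (fine (R * N) M) × Fin (d + 1) => blockOf (R * N) M i.1)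
      ((DeltaA (R * N) M a)⁻¹ * (fdiff (fine (R * N) M) ((R * N : ℕ) : ℂ) ν)ᴴ) C₁' (δ / 2))
    (hG3' : ∀ μ ν, RowDecay M (fun i : Tor (fine (R * N) M) × Fin (d + 1) => blockOf (R * N) M i.1)
      (fun i : Tor (fine (R * N) M) × Fin (d + 1) => blockOf (R * N) M i.1)
      ((DeltaA (R * N) M a)⁻¹ * (fdiff (fine (R * N) M) ((R * N : ℕ) : ℂ) μ)ᴴ * (fdiff (fine (R * N) M) ((R * N : ℕ) : ℂ) ν)ᴴ) C₃' (δ / 2))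
    {g : Tor M × Fin (d + 1) → ℂ} {y' : Tor M} (hg : FieldDecay M Prod.fst g V δ y') :
    FieldDecay M Prod.fst ((covOp (R * N) M a - covOp N M a) *ᵥ g)
      ((((R : ℝ) - 1) / ((R : ℝ) * N)) * epsVec d a C₀ C₀' C₁' C₂ C₃' C₄ δ * V) (δ / 4) y' := by
  have hρ := ratio_nonneg N R
  have hδ2 : 0 < δ / 2 := half_pos hδ
  have hδ4 : 0 < δ / 2 / 2 := half_pos hδ2
  have hK2 := latticeConst_nonneg (d + 1) hδ2.le
  have hK4 := latticeConst_nonneg (d + 1) hδ4.le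
  have hC₀ : 0 ≤ C₀ := hG0.nonneg
  have hC₀' : 0 ≤ C₀' := hG0'.nonneg
  have hC₂ : 0 ≤ C₂ := (hG2 0).nonneg
  have hC₄ : 0 ≤ C₄ := (hG4 0 0).nonneg
  have hC₁' : 0 ≤ C₁' := (hG1' 0).nonneg
  have hC₃' : 0 ≤ C₃' := (hG3' 0 0).nonneg
  have ha' : ‖(a : ℂ)‖ = a := by rw [Complex.norm_real, Real.norm_of_nonneg ha.le]
  -- (A) the fine source `q = Q*g` and the fine field `u = 𝒢q` with its derivatives
  have hq := fieldDecay_QvAdj N M hV hδ.le hg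
  have hu0 : FieldDecay M (fun i : Tor (fine N M) × Fin (d + 1) => blockOf N M i.1) ((DeltaA N M a)⁻¹ *ᵥ (QvAdj N M *ᵥ g))
      (C₀ * (Real.exp δ * V) * latticeConst (d + 1) (δ / 2)) (δ / 2) y' := fieldDecay_mulVec hG0 hδ hq (by positivity)
  have hu2 : ∀ ν, FieldDecay M (fun i : Tor (fine N M) × Fin (d + 1) => blockOf N M i.1)
      (fdiff (fine N M) (N : ℂ) ν *ᵥ ((DeltaA N M a)⁻¹ *ᵥ (QvAdj N M *ᵥ g)))
      (C₂ * (Real.exp δ * V) * latticeConst (d + 1) (δ / 2)) (δ / 2) y' := by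
    intro ν; rw [Matrix.mulVec_mulVec]; exact fieldDecay_mulVec (hG2 ν) hδ hq (by positivity)
  have hu4 : ∀ μ ν, FieldDecay M (fun i : Tor (fine N M) × Fin (d + 1) => blockOf N M i.1)
      (fdiff (fine N M) (N : ℂ) ν *ᵥ (fdiff (fine N M) (N : ℂ) μ *ᵥ ((DeltaA N M a)⁻¹ *ᵥ (QvAdj N M *ᵥ g))))
      (C₄ * (Real.exp δ * V) * latticeConst (d + 1) (δ / 2)) (δ / 2) y' := by
    intro μ ν; rw [Matrix.mulVec_mulVec, Matrix.mulVec_mulVec]; exact fieldDecay_mulVec (hG4 ν μ) hδ hq (by positivity)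
  -- (B) the three defect terms at level `RN`, rate `δ/4`
  have hL := fieldDecay_G_Lap_defect N R M (DeltaA (R * N) M a)⁻¹ hδ2 hG1' hG3' _ (by positivity) (by positivity) hu2 (fun ν => hu4 ν ν)
  have hD := fieldDecay_G_gradDiv_defect N R M (DeltaA (R * N) M a)⁻¹ hδ2 hG1' hG3' _ (by positivity) (by positivity) hu2 hu4
  have hP := fieldDecay_G_Pi_defect N R M (DeltaA (R * N) M a)⁻¹ hδ2 hG0' _ (by positivity) hu0
  have e3 : (DeltaA (R * N) M a)⁻¹ *ᵥ ((Lap (R * N) M * stairV N R M - stairV N R M * Lap N M) *ᵥ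
              ((DeltaA N M a)⁻¹ *ᵥ (QvAdj N M *ᵥ g)))
          - (DeltaA (R * N) M a)⁻¹ *ᵥ ((GradOp (fine (R * N) M) ((R * N : ℕ) : ℂ) * (GradOp (fine (R * N) M) ((R * N : ℕ) : ℂ))ᴴ * stairV N R M
              - stairV N R M * (GradOp (fine N M) ((N : ℕ) : ℂ) * (GradOp (fine N M) ((N : ℕ) : ℂ))ᴴ)) *ᵥ ((DeltaA N M a)⁻¹ *ᵥ (QvAdj N M *ᵥ g)))
          + (a : ℂ) • ((DeltaA (R * N) M a)⁻¹ *ᵥ ((adjDefect N R M * QvOp N M + QvAdj (R * N) M * fwdDefect N R M) *ᵥ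
              ((DeltaA N M a)⁻¹ *ᵥ (QvAdj N M *ᵥ g))))
        = (DeltaA (R * N) M a)⁻¹ *ᵥ ((locOp (R * N) M a * stairV N R M - stairV N R M * locOp N M a) *ᵥ
              ((DeltaA N M a)⁻¹ *ᵥ (QvAdj N M *ᵥ g))) := by
    conv_rhs => rw [locOp_stairV_defect, Matrix.add_mulVec, Matrix.sub_mulVec, Matrix.smul_mulVec, Matrix.mulVec_add, Matrix.mulVec_sub,
      Matrix.mulVec_smul]
  have hT3in := e3 ▸ ((hL.sub hD).add (hP.smul (a : ℂ)))
  have hT3 := fieldDecay_QvOp (R * N) M ?pos3 hδ4.le hT3in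
  case pos3 => rw [ha']; positivity
  -- (C) the two direct terms
  have hE2 := fieldDecay_adjDefect N R M hV hδ.le hg
  have hT1in := fieldDecay_mulVec hG0' hδ2 (hE2.mono le_rfl (by positivity) (by linarith : δ / 2 ≤ δ)) (by positivity)
  have hT1 := fieldDecay_QvOp (R * N) M ?pos1 hδ4.le hT1in
  case pos1 => positivity
  have hT2 := fieldDecay_fwdDefect N R M (b := C₀ * (Real.exp δ * V) * latticeConst (d + 1) (δ / 2)) (by positivity) hδ2.le hu0
  -- (D) assembly along the identity
  have e0 : (covOp (R * N) M a - covOp N M a) *ᵥ g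
      = QvOp (R * N) M *ᵥ ((DeltaA (R * N) M a)⁻¹ *ᵥ (adjDefect N R M *ᵥ g))
        + fwdDefect N R M *ᵥ ((DeltaA N M a)⁻¹ *ᵥ (QvAdj N M *ᵥ g))
        - QvOp (R * N) M *ᵥ ((DeltaA (R * N) M a)⁻¹ *ᵥ ((locOp (R * N) M a * stairV N R M - stairV N R M * locOp N M a) *ᵥ
            ((DeltaA N M a)⁻¹ *ᵥ (QvAdj N M *ᵥ g)))) := by
    rw [covOp_succ_sub N R M a ha]
    simp only [Matrix.sub_mulVec, Matrix.add_mulVec, ← Matrix.mulVec_mulVec]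
  rw [e0]
  have key := (hT1.add (hT2.mono le_rfl (by positivity) (by linarith : δ / 2 / 2 ≤ δ / 2))).sub hT3
  have hEps : 0 ≤ epsVec d a C₀ C₀' C₁' C₂ C₃' C₄ δ := by unfold epsVec; positivity
  refine key.mono (le_of_eq ?_) (mul_nonneg (mul_nonneg hρ hEps) hV) (by linarith)
  rw [ha']
  simp only [epsVec]
  ring

/-! ## §3 The kernel reading -/

/-- **THE ONE-STEP DIFFERENCE KERNEL OF `c_n = Q_n𝒢_nQ_n*` DECAYS, MODULO THE LETTERS**: at the indicator source `g = δ_{i′}`: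
`‖(c_{RN} − c_N)(i, i′)‖ ≤ ((R−1)∕(RN))·epsVec·e^{−(δ∕4)|i₁ − i′₁|_{T,∞}}`. [folklore] -/
theorem norm_covOp_succ_sub_apply_le {a : ℝ} (ha : 0 < a) {C₀ C₀' C₁' C₂ C₃' C₄ δ : ℝ} (hδ : 0 < δ)
    (hG0 : RowDecay M (fun i : Tor (fine N M) × Fin (d + 1) => blockOf N M i.1) (fun i : Tor (fine N M) × Fin (d + 1) => blockOf N M i.1)
      (DeltaA N M a)⁻¹ C₀ δ)
    (hG2 : ∀ ν, RowDecay M (fun i : Tor (fine N M) × Fin (d + 1) => blockOf N M i.1) (fun i : Tor (fine N M) × Fin (d + 1) => blockOf N M i.1)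
      (fdiff (fine N M) (N : ℂ) ν * (DeltaA N M a)⁻¹) C₂ δ)
    (hG4 : ∀ μ ν, RowDecay M (fun i : Tor (fine N M) × Fin (d + 1) => blockOf N M i.1) (fun i : Tor (fine N M) × Fin (d + 1) => blockOf N M i.1)
      (fdiff (fine N M) (N : ℂ) μ * fdiff (fine N M) (N : ℂ) ν * (DeltaA N M a)⁻¹) C₄ δ)
    (hG0' : RowDecay M (fun i : Tor (fine (R * N) M) × Fin (d + 1) => blockOf (R * N) M i.1)
      (fun i : Tor (fine (R * N) M) × Fin (d + 1) => blockOf (R * N) M i.1) (DeltaA (R * N) M a)⁻¹ C₀' (δ / 2))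
    (hG1' : ∀ ν, RowDecay M (fun i : Tor (fine (R * N) M) × Fin (d + 1) => blockOf (R * N) M i.1)
      (fun i : Tor (fine (R * N) M) × Fin (d + 1) => blockOf (R * N) M i.1)
      ((DeltaA (R * N) M a)⁻¹ * (fdiff (fine (R * N) M) ((R * N : ℕ) : ℂ) ν)ᴴ) C₁' (δ / 2))
    (hG3' : ∀ μ ν, RowDecay M (fun i : Tor (fine (R * N) M) × Fin (d + 1) => blockOf (R * N) M i.1)
      (fun i : Tor (fine (R * N) M) × Fin (d + 1) => blockOf (R * N) M i.1)
      ((DeltaA (R * N) M a)⁻¹ * (fdiff (fine (R * N) M) ((R * N : ℕ) : ℂ) μ)ᴴ * (fdiff (fine (R * N) M) ((R * N : ℕ) : ℂ) ν)ᴴ) C₃' (δ / 2))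
    (i i' : Tor M × Fin (d + 1)) :
    ‖(covOp (R * N) M a - covOp N M a) i i'‖
      ≤ (((R : ℝ) - 1) / ((R : ℝ) * N)) * epsVec d a C₀ C₀' C₁' C₂ C₃' C₄ δ
          * Real.exp (-(δ / 4 * torusSupNorm M (rep M i.1 - rep M i'.1))) := by
  have hsrc : FieldDecay M Prod.fst (Pi.single i' (1 : ℂ)) 1 δ i'.1 := by
    intro z
    by_cases hz : z = i'
    · rw [hz, Pi.single_eq_same, norm_one, sub_self, T4EtaRateOperatorTorus.torusSupNorm_zero, mul_zero, neg_zero, Real.exp_zero, mul_one]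
    · rw [Pi.single_eq_of_ne hz, norm_zero]; positivity
  have key := fieldDecay_covOp_succ_sub N R M ha hδ zero_le_one hG0 hG2 hG4 hG0' hG1' hG3' hsrc i
  rw [Matrix.mulVec_single_one, mul_one] at key
  exact key

end Summit.QuantumFields.BalabanUV.Beta.GAN24.AveragedPropagatorOneStepDecay

end
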